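import Summits.CriticalPhenomena.SAWScalingLimit.Theorems.SAWLeftRightFKGFKGToTraversalBoundWitnessAccPureFar
import HarnessLib

/-!
# Witness glue T6, part 1: configuration-free lemmas of the window accounting

Crux `SAWLeftRightFKG.FKGToTraversalBound` (stmt-CriticalPhenomena-1878), line `slit-necklace`, lead
prover-line-stmt-CriticalPhenomena-1878-c5-0; witness glue unit T6 (the window ACCOUNTING along one outline arc of
the free component: `witness_accounting`), part 1 of 3.

Configuration-free ingredients of the accounting: mesh geometry of sites whose coordinates differ by at most one
(`acc_dist_bsite_le`, `acc_abs_dist_sub_le_four`, on top of `pf_dist_meshPoint_le` of `…WitnessAccPureFar`), the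
representatives of a tight window (`acc_tight_reps`), injectivity of tour positions along one arc (`acc_btour_pos_inj`), a boundary
edge is determined by its contact and its direction (`acc_edge_eq`), two counting lemmas (a map with no three
increasing arguments of equal value has fibres of size `≤ 2`, `acc_card_le_two_mul_card`; weakly separated
windows split into two strictly separated halves, `acc_le_two_mul_of_halves`), the propagation of a class along
consecutive same-class contacts (`acc_pure_of_forall_sameCls`, registered), and the final budget arithmetic
(`acc_budget_false`).

All statements folklore; no literature fact; nothing restates the crux.
-/

noncomputable section

open Set
open Literature.Probability.LatticeModels

namespace Summit.CriticalPhenomena.SAWScalingLimit.Theorems.FKGToTraversalBound.SlitNecklace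

/-! ### Mesh geometry -/

/-- The outline site of a boundary edge is within `3δ` of any site whose coordinates differ by at most one from
those of the contact site. [folklore] -/
theorem acc_dist_bsite_le {δ : ℝ} (hδ : 0 ≤ δ) (e : Site 2 × ODir) {x : Site 2}
    (hx : ∀ ii : Fin 2, |(x - bcontact e) ii| ≤ 1) :
    dist (meshPoint δ (bsite e)) (meshPoint δ x) ≤ 3 * δ := by
  have h1 : dist (meshPoint δ (bsite e)) (meshPoint δ (bcontact e)) = δ := by
    show dist (meshPoint δ e.1) (meshPoint δ (e.1 + e.2.vec)) = δ
    rw [Literature.Probability.Percolation.dist_meshPoint_of_adj (ODir.adj_add_vec e.1 e.2), abs_of_nonneg hδ]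
  have h2 := pf_dist_meshPoint_le hδ hx
  rw [dist_comm] at h2
  linarith [dist_triangle (meshPoint δ (bsite e)) (meshPoint δ (bcontact e)) (meshPoint δ x)]

/-- Two sites both within one lattice unit (coordinatewise) of a third site have mesh points whose distances to
any point differ by at most `4δ`. [folklore] -/
theorem acc_abs_dist_sub_le_four {δ : ℝ} (hδ : 0 ≤ δ) {x x' z : Site 2} (y : ℂ)
    (hx : ∀ ii : Fin 2, |(x - z) ii| ≤ 1) (hx' : ∀ ii : Fin 2, |(x' - z) ii| ≤ 1) :
    |dist (meshPoint δ x) y - dist (meshPoint δ x') y| ≤ 4 * δ := by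
  refine (abs_dist_sub_le _ _ _).trans ?_
  have h1 := pf_dist_meshPoint_le hδ hx
  have h2 := pf_dist_meshPoint_le hδ hx'
  linarith [dist_triangle_right (meshPoint δ x) (meshPoint δ x') (meshPoint δ z)]

/-- Consecutive vertices of a lattice walk have mesh points whose distances to any point differ by at most `δ`.
[folklore] -/
theorem acc_abs_dist_succ_le {δ : ℝ} (hδ : 0 ≤ δ) {u v : Site 2} (p : (zdGraph 2).Walk u v) (y : ℂ) {k : ℕ}
    (hk : k < p.length) :
    |dist (meshPoint δ (p.getVert k)) y - dist (meshPoint δ (p.getVert (k + 1))) y| ≤ δ := by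
  refine (abs_dist_sub_le _ _ _).trans ?_
  rw [Literature.Probability.Percolation.dist_meshPoint_of_adj (p.adj_getVert_succ hk), abs_of_nonneg hδ]

/-- **Representatives of a tight window.**  A window `a < b ≤ |p|` of a lattice walk whose end vertices lie on
opposite sides of a shell of width `> 2δ` has `a + 1 < b`, and its REPRESENTATIVES `a + 1`, `b - 1` are within
`δ` of the respective sides. [folklore] -/
theorem acc_tight_reps {δ : ℝ} (hδ : 0 ≤ δ) {u v : Site 2} (p : (zdGraph 2).Walk u v) (y : ℂ) {σ₁ σ₂ : ℝ}
    (hw : 2 * δ < σ₂ - σ₁) {a b : ℕ} (hab : a < b) (hb : b ≤ p.length)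
    (hside : (dist (meshPoint δ (p.getVert a)) y ≤ σ₁ ∧ σ₂ ≤ dist (meshPoint δ (p.getVert b)) y) ∨
      (σ₂ ≤ dist (meshPoint δ (p.getVert a)) y ∧ dist (meshPoint δ (p.getVert b)) y ≤ σ₁)) :
    a + 1 < b ∧
      ((dist (meshPoint δ (p.getVert (a + 1))) y ≤ σ₁ + δ ∧ σ₂ - δ ≤ dist (meshPoint δ (p.getVert (b - 1))) y) ∨
        (σ₂ - δ ≤ dist (meshPoint δ (p.getVert (a + 1))) y ∧ dist (meshPoint δ (p.getVert (b - 1))) y ≤ σ₁ + δ)) := by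
  have ha := acc_abs_dist_succ_le hδ p y (k := a) (by omega)
  obtain ⟨b', rfl⟩ : ∃ b', b = b' + 1 := ⟨b - 1, by omega⟩
  have hb' := acc_abs_dist_succ_le hδ p y (k := b') (by omega)
  rw [abs_le] at ha hb'
  simp only [Nat.add_sub_cancel]
  have hlt : a + 1 < b' + 1 := by
    by_contra hle
    obtain rfl : b' = a := by omega
    rcases hside with ⟨h1, h2⟩ | ⟨h1, h2⟩ <;> linarith
  refine ⟨hlt, ?_⟩
  rcases hside with ⟨h1, h2⟩ | ⟨h1, h2⟩
  · exact Or.inl ⟨by linarith, by linarith⟩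
  · exact Or.inr ⟨by linarith, by linarith⟩

/-! ### Tour positions and edges -/

/-- A boundary edge is determined by its contact site and its direction. [folklore] -/
theorem acc_edge_eq {e e' : Site 2 × ODir} (hc : bcontact e = bcontact e') (hd : e.2 = e'.2) : e = e' := by
  refine Prod.ext ?_ hd
  have h1 : e.1 = bcontact e - e.2.vec := by simp [bcontact]
  have h2 : e'.1 = bcontact e' - e'.2.vec := by simp [bcontact]
  rw [h1, h2, hc, hd]

/-- **Positions along one arc carry distinct edges.**  For a tour with injective period `N` and the arc
`[m, n] ∈ {[0, n₁], [n₁, N]}` (`0 < n₁ < N`), two positions of the arc with the same edge are equal. [folklore] -/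
theorem acc_btour_pos_inj (A : Set (Site 2)) (e₀ : Site 2 × ODir) {n₁ N m n : ℕ} (hn₁ : 0 < n₁)
    (hper : btour A e₀ N = e₀) (hinj : ∀ j j', j < N → j' < N → btour A e₀ j = btour A e₀ j' → j = j')
    (hmn : (m = 0 ∧ n = n₁) ∨ (m = n₁ ∧ n = N)) (hn₁N : n₁ < N) {P P' : ℕ} (hP : m ≤ P ∧ P ≤ n)
    (hP' : m ≤ P' ∧ P' ≤ n) (h : btour A e₀ P = btour A e₀ P') : P = P' := by
  have key : ∀ Q, m ≤ Q → Q ≤ n → ∃ Q', Q' < N ∧ btour A e₀ Q = btour A e₀ Q' ∧ (Q = Q' ∨ (Q = N ∧ Q' = 0)) := by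
    intro Q _ h2
    by_cases hQ : Q < N
    · exact ⟨Q, hQ, rfl, Or.inl rfl⟩
    · obtain rfl : Q = N := by rcases hmn with ⟨rfl, rfl⟩ | ⟨rfl, rfl⟩ <;> omega
      exact ⟨0, by omega, by rw [hper, btour_zero], Or.inr ⟨rfl, rfl⟩⟩
  obtain ⟨Q, hQ, hQe, hQc⟩ := key P hP.1 hP.2
  obtain ⟨Q', hQ', hQ'e, hQ'c⟩ := key P' hP'.1 hP'.2
  have := hinj Q Q' hQ hQ' (by rw [← hQe, ← hQ'e, h])
  rcases hmn with ⟨rfl, rfl⟩ | ⟨rfl, rfl⟩ <;> omega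

/-! ### Counting -/

/-- **Fibres of size at most two.**  If no three arguments `x₁ < x₂ < x₃` of `s` have `f x₁ = f x₃`, and `f`
maps `s` into `t`, then `#s ≤ 2 #t`. [folklore] -/
theorem acc_card_le_two_mul_card {α β : Type*} [LinearOrder α] (s : Finset α) (t : Finset β) (f : α → β)
    (hf : ∀ x ∈ s, f x ∈ t) (h3 : ∀ x₁ ∈ s, ∀ x₂ ∈ s, ∀ x₃ ∈ s, x₁ < x₂ → x₂ < x₃ → f x₁ ≠ f x₃) :
    s.card ≤ 2 * t.card := by
  classical
  refine Finset.card_le_mul_card_image_of_maps_to hf 2 fun b _ => ?_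
  by_contra hlt
  rw [not_le, Finset.two_lt_card] at hlt
  obtain ⟨x, hx, y, hy, z, hz, hxy, hxz, hyz⟩ := hlt
  simp only [Finset.mem_filter] at hx hy hz
  have key : ∀ u v w : α, u ∈ s ∧ f u = b → v ∈ s ∧ f v = b → w ∈ s ∧ f w = b → u < v → v < w → False :=
    fun u v w hu hv hw huv hvw => h3 u hu.1 v hv.1 w hw.1 huv hvw (hu.2.trans hw.2.symm)
  rcases lt_or_gt_of_ne hxy with hxy | hxy <;> rcases lt_or_gt_of_ne hyz with hyz | hyz <;>
    rcases lt_or_gt_of_ne hxz with hxz | hxz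
  · exact key x y z hx hy hz hxy hyz
  · exact lt_asymm (hxy.trans hyz) hxz
  · exact key x z y hx hz hy hxz hyz
  · exact key z x y hz hx hy hxz hxy
  · exact key y x z hy hx hz hxy hxz
  · exact key y z x hy hz hx hyz hxz
  · exact lt_asymm (hyz.trans hxy) hxz
  · exact key z y x hz hy hx hyz hxy

/-- **Two halves of weakly separated windows.**  If `q` windows `Pa mm < Pb mm` are weakly separated
(`Pb mm ≤ Pa mm'` for `mm < mm'`) and every strictly separated sub-family has at most `nB` members, then
`q ≤ 2 nB` (the even-indexed and the odd-indexed windows are strictly separated). [folklore] -/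
theorem acc_le_two_mul_of_halves (q nB : ℕ) (Pa Pb : Fin q → ℕ) (h1 : ∀ mm, Pa mm < Pb mm)
    (h2 : ∀ ⦃mm mm' : Fin q⦄, mm < mm' → Pb mm ≤ Pa mm')
    (H : ∀ (r : ℕ) (ι : Fin r → Fin q), (∀ ⦃k k' : Fin r⦄, k < k' → Pb (ι k) < Pa (ι k')) → r ≤ nB) :
    q ≤ 2 * nB := by
  have gap : ∀ ⦃mm mm' : Fin q⦄, mm.val + 2 ≤ mm'.val → Pb mm < Pa mm' := by
    intro mm mm' h
    have hmid : mm.val + 1 < q := by omega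
    calc Pb mm ≤ Pa ⟨mm.val + 1, hmid⟩ := h2 (Fin.lt_def.2 (by simp))
      _ < Pb ⟨mm.val + 1, hmid⟩ := h1 _
      _ ≤ Pa mm' := h2 (Fin.lt_def.2 (by simp only; omega))
  have he : (q + 1) / 2 ≤ nB :=
    H ((q + 1) / 2) (fun k => ⟨2 * k.val, by omega⟩) fun k k' hkk' => gap (by
      have := Fin.lt_def.1 hkk'; simp only; omega)
  have ho : q / 2 ≤ nB :=
    H (q / 2) (fun k => ⟨2 * k.val + 1, by omega⟩) fun k k' hkk' => gap (by
      have := Fin.lt_def.1 hkk'; simp only; omega)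
  omega

/-- **The budget arithmetic**: the four partial counts cannot add up to the cost `8 (nfar + #S + 2)² (W + nB + 2)`.
[folklore] -/
theorem acc_budget_false (nfar s W nB qmix qfar qch qgood : ℕ) (h1 : qmix ≤ 2 * nfar)
    (h2 : qfar ≤ nfar * (4 * W + 4)) (h3 : qch ≤ 8 * (s + nfar)) (h4 : qgood ≤ 2 * nB)
    (h : 8 * (nfar + s + 2) ^ 2 * (W + nB + 2) ≤ qmix + qfar + (qch + qgood)) : False := by
  have e2 : nfar * (4 * W + 4) = 4 * (nfar * W) + 4 * nfar := by ring
  rw [e2] at h2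
  have hX : 2 ≤ nfar + s + 2 := by omega
  have h5 : 2 * ((nfar + s + 2) * (W + nB + 2)) ≤ (nfar + s + 2) ^ 2 * (W + nB + 2) := by
    have : 2 * (nfar + s + 2) ≤ (nfar + s + 2) * (nfar + s + 2) := Nat.mul_le_mul_right _ hX
    calc 2 * ((nfar + s + 2) * (W + nB + 2)) = (2 * (nfar + s + 2)) * (W + nB + 2) := by ring
      _ ≤ ((nfar + s + 2) * (nfar + s + 2)) * (W + nB + 2) := Nat.mul_le_mul_right _ this
      _ = (nfar + s + 2) ^ 2 * (W + nB + 2) := by ring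
  have h6 : nfar * W ≤ (nfar + s + 2) * W := Nat.mul_le_mul_right W (by omega)
  have h7 : nB ≤ (nfar + s + 2) * nB := Nat.le_mul_of_pos_left nB (by omega)
  have h8 : (nfar + s + 2) * (W + nB + 2) = (nfar + s + 2) * W + (nfar + s + 2) * nB + 2 * (nfar + s + 2) := by
    ring
  rw [h8] at h5
  have h' : 8 * ((nfar + s + 2) ^ 2 * (W + nB + 2)) ≤ qmix + qfar + (qch + qgood) := by rwa [← mul_assoc]
  omega

/-! ### Propagation of classes along a window -/

/-- **Pure windows (registered glue).**  Contacts `c k` along an index interval `[a, b]`, `a < b`; a REST class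
`R` and a family of classes `Vs i` (`good i`), the rest class disjoint from every good class and distinct good
classes disjoint.  If every two consecutive contacts are in the same class (both rest, or both in one good
class), then all contacts of the interval are rest, or all lie in one good class. [folklore] -/
theorem acc_pure_of_forall_sameCls : ∀ {α ι : Type*} (R : α → Prop) (good : ι → Prop) (Vs : ι → Set α) (c : ℕ → α) (a b : ℕ), (∀ i, good i → ∀ z, R z → z ∉ Vs i) → (∀ i i', good i → good i' → i ≠ i' → Disjoint (Vs i) (Vs i')) → a < b → (∀ k, a ≤ k → k < b → (R (c k) ∧ R (c (k + 1))) ∨ ∃ i, good i ∧ c k ∈ Vs i ∧ c (k + 1) ∈ Vs i) → ((∀ k, a ≤ k → k ≤ b → R (c k)) ∨ ∃ i, good i ∧ ∀ k, a ≤ k → k ≤ b → c k ∈ Vs i) := by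
  intro α ι R good Vs c a b hRV hVV hab h
  rcases h a le_rfl hab with ⟨ha, -⟩ | ⟨i, hi, ha, -⟩
  · refine Or.inl fun k hak => Nat.le_induction (m := a) (P := fun k _ => k ≤ b → R (c k)) (fun _ => ha)
      (fun k hak ih hkb => ?_) k hak
    have hk := ih (by omega)
    rcases h k hak (by omega) with ⟨-, h'⟩ | ⟨i, hi, hki, -⟩
    · exact h'
    · exact absurd hki (hRV i hi _ hk)
  · refine Or.inr ⟨i, hi, fun k hak => Nat.le_induction (m := a) (P := fun k _ => k ≤ b → c k ∈ Vs i)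
      (fun _ => ha) (fun k hak ih hkb => ?_) k hak⟩
    have hk := ih (by omega)
    rcases h k hak (by omega) with ⟨hR, -⟩ | ⟨i', hi', hki', hk1⟩
    · exact absurd hk (hRV i hi _ hR)
    · have : i' = i := by
        by_contra hne
        exact Set.disjoint_left.1 (hVV i' i hi' hi hne) hki' hk
      subst this
      exact hk1

end Summit.CriticalPhenomena.SAWScalingLimit.Theorems.FKGToTraversalBound.SlitNecklace

end
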